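import Mathlib
import Summits.ValiantsHypothesis.ValiantsHypothesis.Theorems.GeneratorObstructionsPowGenDegreeQPGadgetTableauFrame
import Summits.ValiantsHypothesis.ValiantsHypothesis.Theorems.GeneratorObstructionsPowGenDegreeQPGadgetTableauCounts
import Summits.ValiantsHypothesis.ValiantsHypothesis.Theorems.GeneratorObstructionsPowGenDegreeQPGadgetEval

/-!
# Route GeneratorObstructions — crux K2 `PowGenDegreeQP` (stmt-ValiantsHypothesis-11655), line
# `trace-side-regimes`: TYPE PRESERVATION for the gadget tableau

Companion of `…GadgetTableauDefs/Frame/Counts` and `…GadgetEval`.  For the gadget tableau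
`τ = gadgetTab k c hk hc x` on an antitone enumeration `x` of the letters and a tuple of column
permutations `π`, suppose every label `u` receives SOME gadget monomial: `content π u = gadgetExp (J u)`.
Then `J u` is the block of `u` (`gadgetTab_block_eq`).  Steps: (a) the row-sum identity
`Σ_u (content π u)(x ρ) = #{n | ρ < h n}` (`sum_content_apply`, via the frame) at the row of `B_j`
gives `#{u | J u = j} = 3·2^j` (`card_fiber_J`); (b) the first pair box of `u` lies in a type-`labBlock u`
column, whose letters have blocks `≥ labBlock u`, so `labBlock u ≤ J u` (`labBlock_le_J`);
(c) `eq_of_le_of_card_fiber_eq`.  This is the first half of the remaining certificate theorem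
`gadgetTab_count` (skeleton attached to the item); the second half is the factorisation of the
type-respecting rearrangements into `D*` blocks (`blockSum`).

Honest framing: combinatorics of one explicit tableau; no stub, crux or summit is settled here;
`VP ≠ VNP` untouched. [folklore]
-/

namespace Summit.ValiantsHypothesis.ValiantsHypothesis.Theorems.GeneratorObstructions.PowGenDegreeQP

open Literature.Computability.AlgebraicComplexity Literature.Computability.AlgebraicComplexity.TableauEval

-- `Summit.ValiantsHypothesis.ValiantsHypothesis.…` is the tree's mandated single-conjunct layout.
set_option linter.dupNamespace false

noncomputable section

variable {σ : Type*} [LinearOrder σ]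

/-! ## §1 Letters of the enumeration -/

/-- The block letters `x (letterRow c j κ)` are pairwise distinct (`x` antitone on `[0,N)`,
`3c ≤ N`). [folklore] -/
theorem letter_inj {c : ℕ} {x : ℕ → σ} {N : ℕ} (hx : IsAntitoneEnum x N) (hN : 3 * c ≤ N)
    {j j' : ℕ} (hj : j < c) (hj' : j' < c) {κ κ' : Fin 3}
    (h : x (letterRow c j κ) = x (letterRow c j' κ')) : j = j' ∧ κ = κ' := by
  have h1 : letterRow c j κ < 3 * c := by unfold letterRow; omega
  have h2 : letterRow c j' κ' < 3 * c := by unfold letterRow; omega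
  exact letterRow_inj hj hj' (hx.inj (by omega) (by omega) h)

/-- Value of a gadget monomial at a `B`-letter: `k` on its own block, `0` elsewhere. [folklore] -/
theorem gadgetExp_apply_rowB {c : ℕ} (k : ℕ) {x : ℕ → σ} {N : ℕ} (hx : IsAntitoneEnum x N)
    (hN : 3 * c ≤ N) {j : ℕ} (hj : j < c) (j' : Fin c) :
    gadgetExp k (fun i : Fin c => x (letterRow c i 2)) (fun i => x (letterRow c i 1))
        (fun i => x (letterRow c i 0)) j' (x (letterRow c j 2)) =
      if j'.val = j then k else 0 := by
  classical
  simp only [gadgetExp, Finsupp.coe_add, Pi.add_apply, Finsupp.single_apply]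
  have hA : x (letterRow c j' 1) ≠ x (letterRow c j 2) := fun h =>
    absurd (letter_inj hx hN j'.isLt hj h).2 (by decide)
  have hA' : x (letterRow c j' 0) ≠ x (letterRow c j 2) := fun h =>
    absurd (letter_inj hx hN j'.isLt hj h).2 (by decide)
  rw [if_neg hA, if_neg hA', add_zero, add_zero]
  by_cases hjj : j'.val = j
  · rw [if_pos hjj, if_pos (by rw [hjj])]
  · rw [if_neg hjj, if_neg (fun h => hjj (letter_inj hx hN j'.isLt hj h).1)]

/-- A letter in the support of a gadget monomial is one of its three block letters. [folklore] -/
theorem exists_kind_of_gadgetExp_ne_zero {c : ℕ} (k : ℕ) {x : ℕ → σ} (j' : Fin c) {v : σ}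
    (h : gadgetExp k (fun i : Fin c => x (letterRow c i 2)) (fun i => x (letterRow c i 1))
        (fun i => x (letterRow c i 0)) j' v ≠ 0) :
    ∃ κ : Fin 3, v = x (letterRow c j' κ) := by
  classical
  simp only [gadgetExp, Finsupp.coe_add, Pi.add_apply, Finsupp.single_apply] at h
  by_cases h2 : x (letterRow c j' 2) = v
  · exact ⟨2, h2.symm⟩
  by_cases h1 : x (letterRow c j' 1) = v
  · exact ⟨1, h1.symm⟩
  by_cases h0 : x (letterRow c j' 0) = v
  · exact ⟨0, h0.symm⟩
  rw [if_neg h2, if_neg h1, if_neg h0] at h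
  exact absurd rfl h

/-! ## §2 The row-sum identity -/

/-- In a column, exactly one box receives a given row (if the row lies in the column). [folklore] -/
theorem card_filter_perm_val_eq {h : ℕ} (π : Equiv.Perm (Fin h)) (ρ : ℕ) :
    (Finset.univ.filter fun r : Fin h => (π r).val = ρ).card = if ρ < h then 1 else 0 := by
  split_ifs with hρ
  · rw [Finset.card_eq_one]
    refine ⟨π.symm ⟨ρ, hρ⟩, ?_⟩
    ext r
    simp only [Finset.mem_filter, Finset.mem_univ, true_and, Finset.mem_singleton]
    constructor
    · intro hr
      have : π r = ⟨ρ, hρ⟩ := Fin.ext hr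
      rw [← this, Equiv.symm_apply_apply]
    · rintro rfl
      simp
  · rw [Finset.card_eq_zero, Finset.filter_eq_empty_iff]
    intro r _ hr
    exact hρ (hr ▸ (π r).isLt)

/-- **Row sums**: for every row `ρ < 3c`, the letters `x ρ` received by all labels together number
`#{n | ρ < h n}` (each column hands out each of its rows exactly once). [folklore] -/
theorem sum_content_apply (k c : ℕ) (hk : 1 ≤ k) (hc : 1 ≤ c) {x : ℕ → σ} {N : ℕ}
    (hx : IsAntitoneEnum x N) (hN : 3 * c ≤ N) (π : (gadgetTab k c hk hc x).Bij) {ρ : ℕ}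
    (hρ : ρ < 3 * c) :
    ∑ u, (gadgetTab k c hk hc x).content π u (x ρ) =
      (Finset.univ.filter fun n : Fin (gadgetTab k c hk hc x).C =>
        ρ < (gadgetTab k c hk hc x).h n).card := by
  classical
  -- `content π u (x ρ) = #{s | word π u s = x ρ}`
  have h1 : ∀ u, (gadgetTab k c hk hc x).content π u (x ρ) =
      ∑ s : Fin (gadgetTab k c hk hc x).m, if (gadgetTab k c hk hc x).word π u s = x ρ then 1 else 0 := by
    intro u
    rw [TabM.content, wordContent_apply, Finset.card_filter]
  simp_rw [h1]
  -- reindex the double sum over boxes through the frame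
  rw [← Fintype.sum_prod_type']
  rw [Fintype.sum_equiv (gadgetTabFrame k c hk hc x).boxEquiv (fun p : Fin (gadgetTab k c hk hc x).d × Fin (gadgetTab k c hk hc x).m => if (gadgetTab k c hk hc x).word π p.1 p.2 = x ρ then 1 else 0)
    (fun b : (n : Fin (gadgetTab k c hk hc x).C) × Fin ((gadgetTab k c hk hc x).h n) => if x ((π b.1 b.2).val) = x ρ then 1 else 0) ?_]
  · rw [Fintype.sum_sigma]
    rw [Finset.card_filter]
    refine Finset.sum_congr rfl fun n _ => ?_
    have hinj : ∀ r : Fin ((gadgetTab k c hk hc x).h n), (x ((π n r).val) = x ρ ↔ (π n r).val = ρ) := by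
      intro r
      have hr : (π n r).val < N := lt_of_lt_of_le ((π n r).isLt)
        ((colHeight_le k c n).trans hN)
      exact ⟨fun h => hx.inj hr (by omega) h, fun h => by rw [h]⟩
    simp_rw [hinj]
    rw [← Finset.card_filter, card_filter_perm_val_eq]
  · intro p
    rfl

/-! ## §3 Type preservation -/

/-- **(a) Fibre counts of `J`**: if every label receives the gadget monomial of block `J u`, then
exactly `3·2^j` labels have `J u = j`. [folklore] -/
theorem card_fiber_J (k c : ℕ) (hk : 1 ≤ k) (hc : 1 ≤ c) {x : ℕ → σ} {N : ℕ}
    (hx : IsAntitoneEnum x N) (hN : 3 * c ≤ N) (π : (gadgetTab k c hk hc x).Bij)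
    (J : Fin (gadgetTab k c hk hc x).d → Fin c)
    (hJ : ∀ u, (gadgetTab k c hk hc x).content π u =
      gadgetExp k (fun i : Fin c => x (letterRow c i 2)) (fun i => x (letterRow c i 1))
        (fun i => x (letterRow c i 0)) (J u))
    {j : ℕ} (hj : j < c) :
    (Finset.univ.filter fun u => (J u).val = j).card = 3 * 2 ^ j := by
  classical
  have hρ : letterRow c j 2 < 3 * c := by unfold letterRow; omega
  have hsum := sum_content_apply k c hk hc hx hN π hρ
  simp_rw [hJ, gadgetExp_apply_rowB k hx hN hj] at hsum
  rw [Finset.sum_ite, Finset.sum_const_zero, add_zero, Finset.sum_const, smul_eq_mul] at hsum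
  change _ = (Finset.univ.filter fun n : Fin (3 * k * 2 ^ c) => letterRow c j 2 < colHeight k c n).card
    at hsum
  rw [card_rowB_cols hk hj] at hsum
  have hk0 : 0 < k := hk
  nlinarith [hsum]

/-- **(b) No descent**: the first pair box of `u` lies in a column of type `labBlock u`, whose letters
belong to blocks `≥ labBlock u`; hence `labBlock u ≤ J u`. [folklore] -/
theorem labBlock_le_J (k c : ℕ) (hk : 1 ≤ k) (hc : 1 ≤ c) {x : ℕ → σ} {N : ℕ}
    (hx : IsAntitoneEnum x N) (hN : 3 * c ≤ N) (π : (gadgetTab k c hk hc x).Bij)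
    (J : Fin (gadgetTab k c hk hc x).d → Fin c)
    (hJ : ∀ u, (gadgetTab k c hk hc x).content π u =
      gadgetExp k (fun i : Fin c => x (letterRow c i 2)) (fun i => x (letterRow c i 1))
        (fun i => x (letterRow c i 0)) (J u))
    (u : Fin (gadgetTab k c hk hc x).d) : labBlock u ≤ (J u).val := by
  classical
  obtain ⟨hjc, hq, hjq⟩ := labBlock_lt u
  -- the first pair box `s₀ = 3k`
  let s₀ : Fin (gadgetTab k c hk hc x).m := ⟨3 * k, by change 3 * k < 5 * k; omega⟩
  let n₀ : Fin (gadgetTab k c hk hc x).C := ((gadgetTab k c hk hc x).box u s₀).1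
  let r₀ : Fin ((gadgetTab k c hk hc x).h n₀) := ((gadgetTab k c hk hc x).box u s₀).2
  have hn₀ : n₀.val = 3 * k * 2 ^ labBlock u + 3 * k * labCopy u + pairIdx k (labLab u) 0 := by
    change (boxColRow k c u (3 * k)).1 = _
    unfold boxColRow
    rw [if_neg (lt_irrefl _), Nat.sub_self]
  -- the letter received by that box lies in the content, hence in the support of `gadgetExp (J u)`
  let r₁ : Fin ((gadgetTab k c hk hc x).h n₀) := π n₀ r₀
  have hmem : (gadgetTab k c hk hc x).content π u (x r₁.val) ≠ 0 := by
    rw [TabM.content, wordContent_apply]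
    apply Finset.card_ne_zero_of_mem (a := s₀)
    simp only [Finset.mem_filter, Finset.mem_univ, true_and]
    rfl
  rw [hJ u] at hmem
  obtain ⟨κ, hκ⟩ := exists_kind_of_gadgetExp_ne_zero k (J u) hmem
  have hr₁N : r₁.val < N := lt_of_lt_of_le r₁.isLt ((colHeight_le k c n₀).trans hN)
  have hrow : r₁.val = letterRow c (J u) κ :=
    hx.inj hr₁N (by unfold letterRow; omega) hκ
  -- the column `n₀` is of type `labBlock u`
  have hlt : letterRow c (J u) κ < colHeight k c n₀ := by rw [← hrow]; exact r₁.isLt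
  have hn3 : ¬ n₀.val < 3 * k := by
    rw [hn₀]; have : 1 ≤ 2 ^ labBlock u := Nat.one_le_two_pow; nlinarith
  have hlog := block_le_of_letterRow_lt_colHeight (J u).isLt hn3 κ hlt
  rw [hn₀, log_pairCol hk hq (pairIdx_lt (by omega) (labLab u))] at hlog
  exact hlog

/-- **TYPE PRESERVATION**: if every label receives some gadget monomial under `π`, it receives the
one of its own block. [folklore] -/
theorem gadgetTab_block_eq (k c : ℕ) (hk : 1 ≤ k) (hc : 1 ≤ c) {x : ℕ → σ} {N : ℕ}
    (hx : IsAntitoneEnum x N) (hN : 3 * c ≤ N) (π : (gadgetTab k c hk hc x).Bij)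
    (J : Fin (gadgetTab k c hk hc x).d → Fin c)
    (hJ : ∀ u, (gadgetTab k c hk hc x).content π u =
      gadgetExp k (fun i : Fin c => x (letterRow c i 2)) (fun i => x (letterRow c i 1))
        (fun i => x (letterRow c i 0)) (J u)) :
    ∀ u, (J u).val = labBlock u := by
  classical
  have hle : ∀ u, labBlock (u : Fin (gadgetTab k c hk hc x).d) ≤ (J u).val :=
    labBlock_le_J k c hk hc hx hN π J hJ
  -- both fibre counts are `3·2^j`, so the sums agree
  have hsumJ : ∑ u, (J u).val = ∑ j ∈ Finset.range c, j * (3 * 2 ^ j) := by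
    rw [← Finset.sum_fiberwise_of_maps_to (s := Finset.univ) (t := Finset.range c)
      (g := fun u => (J u).val) (fun u _ => Finset.mem_range.mpr (J u).isLt)]
    refine Finset.sum_congr rfl fun j hj => ?_
    rw [Finset.mem_range] at hj
    rw [Finset.sum_congr rfl (g := fun _ => j) (fun u hu => (Finset.mem_filter.mp hu).2),
      Finset.sum_const, smul_eq_mul, card_fiber_J k c hk hc hx hN π J hJ hj]
    ring
  have hsumB : ∑ u : Fin (gadgetTab k c hk hc x).d, labBlock u =
      ∑ j ∈ Finset.range c, j * (3 * 2 ^ j) := by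
    rw [← Finset.sum_fiberwise_of_maps_to (s := Finset.univ) (t := Finset.range c)
      (g := fun u : Fin (gadgetTab k c hk hc x).d => labBlock u)
      (fun u _ => Finset.mem_range.mpr (labBlock_lt u).1)]
    refine Finset.sum_congr rfl fun j hj => ?_
    rw [Finset.mem_range] at hj
    rw [Finset.sum_congr rfl (g := fun _ => j) (fun u hu => (Finset.mem_filter.mp hu).2),
      Finset.sum_const, smul_eq_mul]
    change (Finset.univ.filter fun u : Fin (3 * (2 ^ c - 1)) => labBlock u = j).card * j = _
    rw [card_labBlock_eq hj]
    ring
  have := eq_of_le_of_card_fiber_eq (fun u => (J u).val) (fun u => labBlock u) hle (hsumJ.trans hsumB.symm)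
  exact fun u => congrFun this u

end

end Summit.ValiantsHypothesis.ValiantsHypothesis.Theorems.GeneratorObstructions.PowGenDegreeQP
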